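import Summits.AtomisticToContinuum.HydrodynamicLimit.Theorems.DiffuseBackwardInfluence.Negative.TransferKernels

/-!
# Vocabulary of the line `share-nondegeneracy-one-flight` for the crux `DiffuseBackwardInfluence`
(stmt-AtomisticToContinuum-12950; rank 3, tier-deciding crux of route `CollisionIsometryCLT`)

Definitions-only support file (`--supports stmt-AtomisticToContinuum-12950`) of the lead prover of the line
(`Cruxes/DiffuseBackwardInfluence/Lines/share-nondegeneracy-one-flight.lean`, `Cruxes/DiffuseBackwardInfluence/PICKED.md`).
It makes the line's vocabulary IMPORTABLE so that each registered stub can land in its own sorry-free Theorems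
file with the registered signature verbatim, and so that the final crux file can import the landed stubs.

Everything is built on the LANDED restatement of the crux's `let M …; let ipr …`
(`Theorems/DiffuseBackwardInfluence/Negative/TransferKernels.lean`: `pre`, `pairsAt`, `step`, `colls`,
`transfer`, `rowIpr`, `ipr`, `normalAt`, with `V3`, `T3`, `Cfg`; `ipr` IS the crux's `let ipr` definitionally, cf.
`fewIdle_of_diffuseBackwardInfluence`). New here:

* the transfer after `n` fold steps `transferN` (`transfer = transferN ∘ colls`, `rfl`), blocks `blockCol`, block
  masses `blockMass` (`a_ik = ‖M_ik‖_F²`; `ipr = (N+1)⁻¹ Σᵢ Σₖ a_ik²` at `n = colls`, `rfl`), shares `blockShare`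
  (`⟨ω, M_ik M_ikᵀ ω⟩`), handed-over fractions `shareFrac`, the realised unit normal `unitNormal`;
* the slot grid `slotStart`, per-slot idleness `IdleOn` / `idleFr`, the first-collision share-degeneracy score
  `HasCollIn` / `Degenerate` / `degScore` / `degFr`, the two-tracer merge mass `mergeAt` and the LATE merge mass
  `lateMergeFr`;
* the homogeneous reference law `eqLaw σ θ` (`localGibbsLaw` with constant profiles `(1, 0, θ)`);
* the STATEMENTS the six registered stubs prove or consume — `RowBudgetN` (row budget `Σₖ a_ik = 3` after any
  number of steps: exact host uniformity of one influence tracer), `OnePathBound` (the PATHWISE one-path bound of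
  the tracer duality), `FewIdleSuperExpAt`, `ShareLDAt`, `LateMergesRareAt`, `EntropyTransferAt` (probability
  form: super-exponentially rare events of the invariant law are negligible along the local-Gibbs-evolved law),
  and `CruxConclusionAt` (verbatim the crux's tail after `∀ Φ`).

Nothing is asserted here: every `def … : Prop` is a predicate the stubs prove or consume, never a hypothesis
taken as a fact. The sorry-free lemmas are elementary range facts (`degFr ∈ [0,1]`, `idleFr ∈ [0,1]`, …) and
the two `rfl` dictionaries.

Mathematics (idea card `share-nondegeneracy-one-flight`, triage r1-2 / r1-3 pass; consumer re-docked to the exact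
tracer duality of card `coalescing-influence-tracers`, AldousLanoue2012 §2.4): `μ_k(i) := a_ik/3` is the law of
ONE influence tracer of source `k` (exchange rule `a'_pk = a_pk − x + y` at a `(p,q)`-contact with shares `x, y`),
`ipr/9 = (N+1)⁻¹ Σₖ P(two conditionally independent tracers of k coincide) = never-split + re-merged` EXACTLY;
never-split mass dies unless the path meets `< m` non-degenerate collisions, which by pigeonhole over `2mL` slots
and exact host uniformity (`RowBudgetN`) costs only `idleFr + degFr` per slot; re-merged mass is fed only by
host–host contacts, whence the single two-body quantity `lateMergeFr`.
-/

namespace Summit.AtomisticToContinuum.HydrodynamicLimit.Theorems.DiffuseBackwardInfluenceShare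

open scoped BigOperators Topology ENNReal InnerProductSpace Classical
open Filter Set MeasureTheory
open Literature.Analysis.FluidPDE (Config HardSphereFlow collidePair)
open Literature.MathematicalPhysics.KineticTheory (localGibbsLaw hsDiameter)
open Summit.AtomisticToContinuum.HydrodynamicLimit.Theorems.DiffuseBackwardInfluenceNeg

noncomputable section

/-- Hard-sphere flows of `N + 1` spheres at reduced density `σ` on `𝕋³` (the crux's `Φ N`). -/
abbrev Flow (σ : ℝ) (N : ℕ) : Type :=
  HardSphereFlow (Literature.Analysis.FluidPDE.Torus.geometry (Fin 3)) (hsDiameter σ N) (N + 1)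

section Vocabulary

variable (σ : ℝ) (N : ℕ)

/-- The frozen-geometry transfer after the first `n` fold steps (collisions `0, …, n-1` of the Alexander construction
from `y`); the crux's `M N y Δ` is `transferN σ N y (colls σ N y Δ)` (`transfer_eq_transferN`, `rfl`). -/
def transferN (y : Cfg N) (n : ℕ) (W : Fin (N + 1) → V3) : Fin (N + 1) → V3 :=
  (List.range n).foldl (step σ N y) W

/-- Dictionary: the landed `transfer` is `transferN` at `n = colls`. -/
theorem transfer_eq_transferN (y : Cfg N) (Δ : ℝ) :
    transfer σ N y Δ = transferN σ N y (colls σ N y Δ) := rfl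

/-- One more fold step: `transferN (n+1) = step n ∘ transferN n`. -/
theorem transferN_succ (y : Cfg N) (n : ℕ) (W : Fin (N + 1) → V3) :
    transferN σ N y (n + 1) W = step σ N y (transferN σ N y n W) n := by
  simp [transferN, List.range_succ, List.foldl_append]

/-- No fold step: `transferN 0 = id`. -/
theorem transferN_zero (y : Cfg N) (W : Fin (N + 1) → V3) : transferN σ N y 0 W = W := rfl

/-- Column `a` of the block `M_ik` after `n` steps: the velocity of particle `i` when the input field is `e_k ⊗ e_a`. -/
def blockCol (y : Cfg N) (n : ℕ) (i k : Fin (N + 1)) (a : Fin 3) : V3 :=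
  transferN σ N y n (Pi.single k (EuclideanSpace.single a (1 : ℝ))) i

/-- Block mass `a_ik(n) = ‖M_ik‖_F²` (row budget `Σ_k a_ik = 3` = `RowBudgetN`; the tracer law of source `k` is
`μ_k(i) = a_ik / 3`, and `ipr = (N+1)⁻¹ Σ_i Σ_k a_ik²` at `n = colls`). -/
def blockMass (y : Cfg N) (n : ℕ) (i k : Fin (N + 1)) : ℝ :=
  ∑ a : Fin 3, ‖blockCol σ N y n i k a‖ ^ 2

/-- Share of the block `M_ik` along a vector `ω`: `ωᵀ M_ik M_ikᵀ ω = Σ_a ⟨ω, M_ik e_a⟩²` — for the realised unit normal,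
the mass particle `i` hands over for source `k` (exact exchange rule, cross terms vanish). -/
def blockShare (y : Cfg N) (n : ℕ) (i k : Fin (N + 1)) (ω : V3) : ℝ :=
  ∑ a : Fin 3, ⟪ω, blockCol σ N y n i k a⟫_ℝ ^ 2

/-- The realised UNIT normal of fold step `k` (`0` if the step reflects nothing). -/
def unitNormal (y : Cfg N) (k : ℕ) : V3 :=
  ‖normalAt σ N y k‖⁻¹ • normalAt σ N y k

/-- Fold step `k` touches particle `i` (it is an endpoint of the reflected pair `h.some`). -/
def Touches (y : Cfg N) (k : ℕ) (i : Fin (N + 1)) : Prop :=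
  ∃ h : (pairsAt σ N y k).Nonempty, h.some.1 = i ∨ h.some.2 = i

/-- The slot grid: the window `[0, Δ]` is cut into `S` slots; slot `r` consists of the fold steps with index in
`[slotStart r, slotStart (r+1))`, `slotStart r = #collisions in [0, rΔ/S]`. -/
def slotStart (y : Cfg N) (Δ : ℝ) (S r : ℕ) : ℕ :=
  colls σ N y ((r : ℝ) * Δ / (S : ℝ))

/-- Particle `i` is idle on slot `r`: no fold step of the slot touches it. -/
def IdleOn (y : Cfg N) (Δ : ℝ) (S r : ℕ) (i : Fin (N + 1)) : Prop :=
  ∀ k, slotStart σ N y Δ S r ≤ k → k < slotStart σ N y Δ S (r + 1) → ¬ Touches σ N y k i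

/-- The idle fraction of slot `r` (`π₀` of the consumer, per slot; `∈ [0,1]`). -/
def idleFr (y : Cfg N) (Δ : ℝ) (S r : ℕ) : ℝ :=
  ((Finset.univ.filter fun i : Fin (N + 1) => IdleOn σ N y Δ S r i).card : ℝ) / ((N + 1 : ℕ) : ℝ)

/-- Particle `i` has a collision in slot `r`. -/
def HasCollIn (y : Cfg N) (Δ : ℝ) (S r : ℕ) (i : Fin (N + 1)) : Prop :=
  ∃ k, slotStart σ N y Δ S r ≤ k ∧ k < slotStart σ N y Δ S (r + 1) ∧ Touches σ N y k i

/-- `η`-degeneracy of a share: the handed-over FRACTION is outside `[η, 1 − η]`. -/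
def Degenerate (η mass share : ℝ) : Prop :=
  share < η * mass ∨ (1 - η) * mass < share

/-- Share-degeneracy score of particle `i` on slot `r`: if `i` collides in the slot, the tracer-law-weighted
(`μ_k(i) = a_ik/3`) indicator that its FIRST collision of the slot is `η`-degenerate for the block `(i, k)` (blocks and
normal read at that first collision — the blocks of `i` have not moved since the slot boundary); `0` if `i` is idle on
the slot (that case is `idleFr`'s). -/
def degScore (y : Cfg N) (Δ : ℝ) (S r : ℕ) (η : ℝ) (i : Fin (N + 1)) : ℝ :=
  if h : HasCollIn σ N y Δ S r i then
    ∑ k : Fin (N + 1), blockMass σ N y (Nat.find h) i k / 3 *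
      (if Degenerate η (blockMass σ N y (Nat.find h) i k)
          (blockShare σ N y (Nat.find h) i k (unitNormal σ N y (Nat.find h))) then 1 else 0)
  else 0

/-- The mean share-degeneracy score of slot `r` (`π_D` of the consumer, per slot), truncated at `1` (it IS `≤ 1` by the
row budget; the truncation only makes `degFr ∈ [0,1]` definitional). -/
def degFr (y : Cfg N) (Δ : ℝ) (S r : ℕ) (η : ℝ) : ℝ :=
  min 1 (((N + 1 : ℕ) : ℝ)⁻¹ * ∑ i : Fin (N + 1), degScore σ N y Δ S r η i)

/-- The handed-over fraction `p = share / mass` (junk `0` for a massless block, which carries no tracer mass). -/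
def shareFrac (y : Cfg N) (n : ℕ) (i k : Fin (N + 1)) (ω : V3) : ℝ :=
  blockShare σ N y n i k ω / blockMass σ N y n i k

/-- Merge mass of the two tracers of source `src` at fold step `k` (hosts `i, j` of the reflected pair, fractions
`p, q`: `2 μ(i) μ(j) (p(1−q) + q(1−p))`; `0` if the step reflects nothing). -/
def mergeAt (y : Cfg N) (src : Fin (N + 1)) (k : ℕ) : ℝ :=
  if h : (pairsAt σ N y k).Nonempty then
    2 * (blockMass σ N y k h.some.1 src / 3) * (blockMass σ N y k h.some.2 src / 3) *
      (shareFrac σ N y k h.some.1 src (unitNormal σ N y k) *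
          (1 - shareFrac σ N y k h.some.2 src (unitNormal σ N y k)) +
        shareFrac σ N y k h.some.2 src (unitNormal σ N y k) *
          (1 - shareFrac σ N y k h.some.1 src (unitNormal σ N y k)))
  else 0

/-- LATE MERGE MASS: source-averaged merge mass of the two tracers during the last `1/L` of the window
(fold steps with index in `[colls((1 − 1/L)Δ), colls Δ)`). The single two-body quantity of the line. -/
def lateMergeFr (y : Cfg N) (Δ : ℝ) (L : ℕ) : ℝ :=
  ((N + 1 : ℕ) : ℝ)⁻¹ * ∑ src : Fin (N + 1),
    ∑ k ∈ Finset.Ico (colls σ N y ((1 - 1 / (L : ℝ)) * Δ)) (colls σ N y Δ), mergeAt σ N y src k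

end Vocabulary

/-- Dictionary (registered sub-goal `ipr_eq_blockMass` of the crux item): the crux's `ipr` is the mean over particles of
`Σ_k a_ik²` at `n = colls` (definitional). -/
theorem ipr_eq_blockMass : ∀ (σ : ℝ) (N : ℕ) (y : Cfg N) (Δ : ℝ), ipr σ N y Δ = ((N + 1 : ℕ) : ℝ)⁻¹ * ∑ i : Fin (N + 1), ∑ k : Fin (N + 1), blockMass σ N y (colls σ N y Δ) i k ^ 2 :=
  fun _ _ _ _ => rfl

/-- The HOMOGENEOUS Gibbs law at rest with temperature `θ` (`localGibbsLaw` with constant profiles `(1, 0, θ)`): the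
invariant reference law (`GibbsInvariance`, stmt-AtomisticToContinuum-9239). -/
def eqLaw (σ θ : ℝ) (N : ℕ) (Φ : Flow σ N) : Measure (Cfg N) :=
  localGibbsLaw σ (fun _ => 1) (fun _ => 0) (fun _ => θ) N Φ

/-! ### Elementary range facts -/

/-- Block masses are nonnegative. -/
theorem blockMass_nonneg (σ : ℝ) (N : ℕ) (y : Cfg N) (n : ℕ) (i k : Fin (N + 1)) :
    0 ≤ blockMass σ N y n i k :=
  Finset.sum_nonneg fun _ _ => sq_nonneg _

/-- Block shares are nonnegative. -/
theorem blockShare_nonneg (σ : ℝ) (N : ℕ) (y : Cfg N) (n : ℕ) (i k : Fin (N + 1)) (ω : V3) :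
    0 ≤ blockShare σ N y n i k ω :=
  Finset.sum_nonneg fun _ _ => sq_nonneg _

/-- Degeneracy scores are nonnegative. -/
theorem degScore_nonneg (σ : ℝ) (N : ℕ) (y : Cfg N) (Δ : ℝ) (S r : ℕ) (η : ℝ) (i : Fin (N + 1)) :
    0 ≤ degScore σ N y Δ S r η i := by
  unfold degScore
  by_cases h : HasCollIn σ N y Δ S r i
  · rw [dif_pos h]
    refine Finset.sum_nonneg fun k _ => mul_nonneg ?_ ?_
    · exact div_nonneg (blockMass_nonneg σ N y _ i k) (by norm_num)
    · by_cases hd : Degenerate η (blockMass σ N y (Nat.find h) i k)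
          (blockShare σ N y (Nat.find h) i k (unitNormal σ N y (Nat.find h)))
      · rw [if_pos hd]; exact zero_le_one
      · rw [if_neg hd]
  · rw [dif_neg h]

/-- `0 ≤ degFr`. -/
theorem degFr_nonneg (σ : ℝ) (N : ℕ) (y : Cfg N) (Δ : ℝ) (S r : ℕ) (η : ℝ) : 0 ≤ degFr σ N y Δ S r η := by
  unfold degFr
  refine le_min zero_le_one (mul_nonneg (inv_nonneg.2 (by positivity)) ?_)
  exact Finset.sum_nonneg fun i _ => degScore_nonneg σ N y Δ S r η i

/-- `degFr ≤ 1` (definitional truncation). -/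
theorem degFr_le_one (σ : ℝ) (N : ℕ) (y : Cfg N) (Δ : ℝ) (S r : ℕ) (η : ℝ) : degFr σ N y Δ S r η ≤ 1 :=
  min_le_left _ _

/-- `0 ≤ idleFr`. -/
theorem idleFr_nonneg (σ : ℝ) (N : ℕ) (y : Cfg N) (Δ : ℝ) (S r : ℕ) : 0 ≤ idleFr σ N y Δ S r :=
  div_nonneg (Nat.cast_nonneg _) (Nat.cast_nonneg _)

/-- `idleFr ≤ 1`. -/
theorem idleFr_le_one (σ : ℝ) (N : ℕ) (y : Cfg N) (Δ : ℝ) (S r : ℕ) : idleFr σ N y Δ S r ≤ 1 := by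
  unfold idleFr
  have hN : (0 : ℝ) < ((N + 1 : ℕ) : ℝ) := by positivity
  rw [div_le_one hN]
  have hc : (Finset.univ.filter fun i : Fin (N + 1) => IdleOn σ N y Δ S r i).card ≤ N + 1 := by
    calc (Finset.univ.filter fun i : Fin (N + 1) => IdleOn σ N y Δ S r i).card
        ≤ (Finset.univ : Finset (Fin (N + 1))).card := Finset.card_filter_le _ _
      _ = N + 1 := by simp
  exact_mod_cast hc

/-- Merge masses vanish at steps that reflect nothing. -/
theorem mergeAt_of_not_nonempty {σ : ℝ} {N : ℕ} {y : Cfg N} {k : ℕ} (h : ¬ (pairsAt σ N y k).Nonempty)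
    (src : Fin (N + 1)) : mergeAt σ N y src k = 0 := by
  unfold mergeAt
  rw [dif_neg h]

/-! ## The statements of the line -/

/-- ROW BUDGET after any number of fold steps: `Σ_k a_ik(n) = Σ_k Σ_a ‖M(n) (e_k ⊗ e_a) i‖² = 3` for every row `i`
(each fold step is a linear isometry of the velocity fields — `reflectVel` at a fixed normal, the identity at normal
`0` — so `M(n)` is orthogonal and every one of the three scalar rows of particle `i` is a unit vector). In tracer
language: the host of ONE influence tracer of a uniformly chosen source is EXACTLY uniform. At `n = colls` this is the
fourth conjunct of the route support item `TransferIsometry` (stmt-AtomisticToContinuum-12951). -/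
def RowBudgetN (σ : ℝ) : Prop :=
  ∀ (N : ℕ) (y : Cfg N) (n : ℕ) (i : Fin (N + 1)), ∑ k : Fin (N + 1), blockMass σ N y n i k = 3

/-- THE ONE-PATH BOUND, PATHWISE (tracer duality + slot pigeonhole + exact host uniformity; no measure theory):
for every configuration `y`, window `Δ > 0`, `η ∈ (0,1)`, depth `m ≥ 1`, `L ≥ 1` and level `b`, if on each of the
`2mL` slots the idle fraction plus the share-degeneracy score is `≤ b`, then
`ipr ≤ 9·(2(1−η)^m + 4b + lateMergeFr L)`.
Content: `ipr/9 = (N+1)⁻¹ Σ_k P(two conditionally independent tracers of k coincide) = never-split + re-merged`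
EXACTLY (`μ_k(i) = a_ik/3` obeys the exchange rule with the adapted fractions `shareFrac`); never-split
`= E_γ[Π b_c] ≤ (1−η)^m + P_γ(< m non-degenerate host collisions)`; `< m` ND collisions force `≥ 2mL − m + 1` bad slots
(host idle on the slot, or host's FIRST collision of the slot `η`-degenerate), Markov's inequality on the bad-slot count
and `RowBudgetN` (host exactly uniform) give `≤ (1−η)^m + Σ_r (idleFr_r + degFr_r)/(2mL−m+1) ≤ (1−η)^m + 2b`; the
re-merged mass splits at the LAST merge: late (last `2m` slots = steps `[colls((1−1/L)Δ), colls Δ)`) `≤ lateMergeFr L`,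
early `⇒` together at `slotStart (2mL−2m)` and never split afterwards `≤ (1−η)^m + Σ_{r ≥ 2mL−2m}(idleFr_r+degFr_r)/(m+1)
≤ (1−η)^m + 2b`. -/
def OnePathBound (σ : ℝ) : Prop :=
  ∀ (N : ℕ) (y : Cfg N) (Δ : ℝ), 0 < Δ → ∀ η : ℝ, 0 < η → η < 1 →
    ∀ m L : ℕ, 1 ≤ m → 1 ≤ L → ∀ b : ℝ,
      (∀ r : ℕ, r < 2 * m * L → idleFr σ N y Δ (2 * m * L) r + degFr σ N y Δ (2 * m * L) r η ≤ b) →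
      ipr σ N y Δ ≤ 9 * (2 * (1 - η) ^ m + 4 * b + lateMergeFr σ N y Δ L)

/-- PER-SLOT IDLENESS IS SUPER-EXPONENTIALLY RARE UNDER THE INVARIANT LAW (ballistic tubes, weakest `m = 0` form): for
every admissible window, every slot of every finite grid, every fraction `δ > 0` and EVERY rate `h`, eventually
`G_N{ idleFr ≥ δ } ≤ e^{−h(N+1)}` (a slot lasts `n_N/S → ∞` mean free times; `δ(N+1)` collision-free particles need
velocity coherence `≈ 3δ(N+1) log(n_N/S)` nats). -/
def FewIdleSuperExpAt (σ θ : ℝ) (Φ : (N : ℕ) → Flow σ N) : Prop :=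
  ∀ Δ : ℕ → ℝ, (∀ N, 0 < Δ N) → Tendsto Δ atTop (𝓝 0) →
    Tendsto (fun N : ℕ => Δ N * ((N + 1 : ℕ) : ℝ) ^ ((1 : ℝ) / 3)) atTop atTop →
    ∀ S r : ℕ, 1 ≤ S → r < S → ∀ δ h : ℝ, 0 < δ → 0 < h →
      ∀ᶠ N : ℕ in atTop,
        eqLaw σ θ N (Φ N) {y | δ ≤ idleFr σ N y (Δ N) S r} ≤
          ENNReal.ofReal (Real.exp (-(h * ((N : ℝ) + 1))))

/-- JOINT FIRST-COLLISION SHARE NON-DEGENERACY AT LARGE-DEVIATION LEVEL (the LEVER, at given `δ, h, η`): under the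
invariant law, on every slot of every grid of every admissible window, eventually `G_N{ degFr(η) ≥ δ } ≤ e^{−h(N+1)}`.
The stub asserts it for `η < η₀(σ, θ, δ, h)`: the rate of "`δ(N+1)` particles' first collisions are `η`-share-degenerate"
DIVERGES as `η ↓ 0`. -/
def ShareLDAt (σ θ δ h η : ℝ) (Φ : (N : ℕ) → Flow σ N) : Prop :=
  ∀ Δ : ℕ → ℝ, (∀ N, 0 < Δ N) → Tendsto Δ atTop (𝓝 0) →
    Tendsto (fun N : ℕ => Δ N * ((N + 1 : ℕ) : ℝ) ^ ((1 : ℝ) / 3)) atTop atTop →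
    ∀ S r : ℕ, 1 ≤ S → r < S →
      ∀ᶠ N : ℕ in atTop,
        eqLaw σ θ N (Φ N) {y | δ ≤ degFr σ N y (Δ N) S r η} ≤
          ENNReal.ofReal (Real.exp (-(h * ((N : ℝ) + 1))))

/-- LATE MERGES ARE RARE (the two-body input, along the local-Gibbs-EVOLVED law): for every admissible window, `t > 0`
and `ε > 0` there is `L` such that eventually the mean merge mass of the two tracers of a uniform source during the last
`1/L` of the window is `≤ ε` (host–host re-touches long after parting are transient in `d = 3`; the named collective
failure is CONFINEMENT of both tracers to `O(1)` hosts at positive density — kill criterion k3 of the route). -/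
def LateMergesRareAt (σ : ℝ) (a₀ θ₀ : T3 → ℝ) (u₀ : T3 → V3) (Φ : (N : ℕ) → Flow σ N) : Prop :=
  ∀ Δ : ℕ → ℝ, (∀ N, 0 < Δ N) → Tendsto Δ atTop (𝓝 0) →
    Tendsto (fun N : ℕ => Δ N * ((N + 1 : ℕ) : ℝ) ^ ((1 : ℝ) / 3)) atTop atTop →
    ∀ t : ℝ, 0 < t → ∀ ε : ℝ, 0 < ε → ∃ L : ℕ, 1 ≤ L ∧
      ∀ᶠ N : ℕ in atTop,
        ∫⁻ z, ENNReal.ofReal (lateMergeFr σ N ((Φ N).flow (t - Δ N) z) (Δ N) L)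
            ∂(localGibbsLaw σ a₀ u₀ θ₀ N (Φ N)) ≤ ENNReal.ofReal ε

/-- ENTROPY TRANSFER, PROBABILITY FORM (backwards entropy method, at reference temperature `θ` with budget constant
`C`): for every flow family and every family of EVENTS `B_N` of the configuration space, a super-exponential bound
`G_N(B_N) ≤ e^{−h(N+1)}` (eventually) at a rate `h > C` implies that, along the local Gibbs law pushed by ANY flow
times `s_N`, `P_N(Φ_{s_N} ∈ B_N) ≤ ε` eventually, for every `ε > 0`. Two proofs: (KL) `GibbsInvariance` + `FrostBudget`
`H(localGibbsLaw | eqLaw θ) ≤ C(N+1)` + the entropy inequality `P[A] ≤ (log 2 + H(P|G))/log(1 + 1/G[A])`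
(`Literature.Probability.Entropy.KipnisLandim1999_A1_8_2_holds`); (density) for `θ > sup θ₀` the density
`d(localGibbsLaw)/d(eqLaw θ)` is bounded by `e^{C(N+1)}` pointwise, so `P(Φ⁻¹B) ≤ e^{C(N+1)} G(Φ⁻¹B') = e^{C(N+1)} G(B)`
for the measurable hull `B'` of `B` and `GibbsInvariance`. -/
def EntropyTransferAt (σ θ C : ℝ) (a₀ θ₀ : T3 → ℝ) (u₀ : T3 → V3) : Prop :=
  ∀ (Φ : (N : ℕ) → Flow σ N) (B : (N : ℕ) → Set (Cfg N)) (h : ℝ), C < h →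
    (∀ᶠ N : ℕ in atTop, eqLaw σ θ N (Φ N) (B N) ≤ ENNReal.ofReal (Real.exp (-(h * ((N : ℝ) + 1))))) →
    ∀ (s : ℕ → ℝ) (ε : ℝ), 0 < ε →
      ∀ᶠ N : ℕ in atTop,
        localGibbsLaw σ a₀ u₀ θ₀ N (Φ N) ((Φ N).flow (s N) ⁻¹' B N) ≤ ENNReal.ofReal ε

/-- The crux's conclusion at fixed `(σ, profiles, flow family)`: for every admissible window and `t > 0`,
`E_{localGibbs}[ipr(Φ_{t−Δ_N} z, Δ_N)] → 0` (literally the tail of `DiffuseBackwardInfluence` after its `∃ σ₀ ∀ σ < σ₀`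
prefix, the `let`s being `DiffuseBackwardInfluenceNeg.transfer/ipr`). -/
def CruxConclusionAt (σ : ℝ) (a₀ θ₀ : T3 → ℝ) (u₀ : T3 → V3) (Φ : (N : ℕ) → Flow σ N) : Prop :=
  ∀ Δ : ℕ → ℝ, (∀ N, 0 < Δ N) → Tendsto Δ atTop (𝓝 0) →
    Tendsto (fun N : ℕ => Δ N * ((N + 1 : ℕ) : ℝ) ^ ((1 : ℝ) / 3)) atTop atTop →
    ∀ t : ℝ, 0 < t →
      Tendsto (fun N : ℕ => ∫⁻ z, ENNReal.ofReal (ipr σ N ((Φ N).flow (t - Δ N) z) (Δ N))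
        ∂(localGibbsLaw σ a₀ u₀ θ₀ N (Φ N))) atTop (𝓝 0)

end

end Summit.AtomisticToContinuum.HydrodynamicLimit.Theorems.DiffuseBackwardInfluenceShare
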